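import Summits.BirchSwinnertonDyer.BirchSwinnertonDyer.Theorems.ResidualThetaTransportAtTwoThetaLayerLambdaCongruenceAtTwoStarCruxGlue
import Summits.BirchSwinnertonDyer.BirchSwinnertonDyer.Theorems.ResidualThetaTransportAtTwoThetaLayerLambdaCongruenceAtTwoCurveMuUndepleted
import HarnessLib

/-!
# Crux `ThetaLayerLambdaCongruenceAtTwo` (stmt-BirchSwinnertonDyer-20688), line `birth` v11: THE CRUX BY NAME from SEVEN NAMED FACTS + (μ-W₀)

Lead prover bsd-wall-rtt-p3 g7 (`--supports stmt-BirchSwinnertonDyer-20688`; closes nothing). ONE composition THEOREM, no definition; the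
crux is NOT closed: its hypotheses are seven Literature named facts (print) and ONE research statement (μ-W₀); BSD is not proved by this.

`thetaLayerLambdaCongruenceAtTwo_of_facts_plusSymbolMax` = w3 g3's `thetaLayerLambdaCongruenceAtTwo_of_facts_curveMax_deligne`
(`…StarCruxGlue`, p605109: Eichler–Shimura depleted optimal quotient · Faltings · Mazur–Kenku · Hecke self-duality of `J₀[2]` · Buzzard's
mod-`2` multiplicity one · Serre 1972 Prop. 12 · (μ-W₁) · Deligne ⟹ crux) with its curve-side `μ`-input (μ-W₁) («the `S₀`-DEPLETED plus
symbol of `W` attains its `2`-adic maximum over `ℚ` at a `2`-power cusp of an even layer», for every admissible `S₀`) REPLACED by the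
undepleted, scale-free (μ-W₀) «the plus symbol `[·]⁺_f` attains its `2`-adic maximum over `ℚ` at a `2`-power cusp `γ^s/2^{n₁+2}` of an even
layer» = `μ(ϑ_{n₁}(f)) = 0` at the cohomological period (Perrin-Riou's `μ⁺ = 0` conjecture read at `p = 2`; conjecture-grade; 596/596
habitat⁺ classes of conductor `< 10⁴` pass, `Cruxes/…/Lines/birth-muW0-instrument.md`), through the lead's
`stub_curveDepletedSymbolMaxAtTwoPowerCusp_of_undepleted` (`…CurveMuUndepleted`, p608093). This is the exact-type glue the route pen needs
to file the twin «KanP := PUB⁷ → (μ-W₀) → Kan⁺» and the conjecture-grade item (μ-W₀) (text = the hypothesis `hμ0` below, verbatim the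
registered stub `stub_curvePlusSymbolMaxAtTwoPowerCusp` of skeleton v11 `c6cf6b878390d60d`).

References: [GreenbergVatsal2000] §1 (10), Prop. (2.4); [PollackWeston2011MT] §3.1, Thm. 4.1, Rem. 4.2; [Buzzard2000LevelLoweringModTwo]
Prop. 2.4; [Deligne1974] Thm. 8.2.
-/

noncomputable section

-- justification: the `Summit.BirchSwinnertonDyer.BirchSwinnertonDyer.…` path repeats a component (route-file convention)
set_option linter.dupNamespace false

open scoped Classical MatrixGroups Polynomial

open Literature.NumberTheory.EllipticCurves Literature.NumberTheory.EllipticCurves.ModularForms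
open Literature.NumberTheory.IwasawaTheory

namespace Summit.BirchSwinnertonDyer.BirchSwinnertonDyer.Theorems.ThetaLayerLambdaCongruenceAtTwo

/-- **THE CRUX `ThetaLayerLambdaCongruenceAtTwo` BY NAME from SEVEN NAMED FACTS + (μ-W₀).** Hypotheses: the Literature named facts
`eichlerShimura_depletedOptimalQuotient_periodLattice_of_dvd`, `WeierstrassCurve.isIsogenous_iff_frobeniusTrace_eq` (Faltings),
`mazurKenku_exists_cyclic_isogeny`, `heckeSelfDual_torsionBy_J0`, `buzzard2000_multiplicityOne_gamma0`,
`serre1972_supersingular_decompositionSubgroup_image`, `Deligne1974_heckeT_eigenvalue_norm_le`, and the single research statement (μ-W₀)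
«for every habitat⁺ curve `W` and its newform `f`, the plus symbol `[·]⁺_f` attains its `2`-adic maximum over `ℚ` at a `2`-power cusp of
some even layer» (`μ(ϑ_n(f)) = 0` at the cohomological period; Perrin-Riou's `μ⁺ = 0` conjecture read at `p = 2`). Composition of
p605109 with `stub_curveDepletedSymbolMaxAtTwoPowerCusp_of_undepleted` (p608093). BSD is not proved by this.
[cite: GreenbergVatsal2000, §1 (10) and Prop. (2.4) (shape)] [cite: PollackWeston2011MT, Rem. 4.2 (μ^± = 0 conjectured; shape only)] -/
theorem thetaLayerLambdaCongruenceAtTwo_of_facts_plusSymbolMax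
    (hES : eichlerShimura_depletedOptimalQuotient_periodLattice_of_dvd)
    (hF : WeierstrassCurve.isIsogenous_iff_frobeniusTrace_eq) (hMK : mazurKenku_exists_cyclic_isogeny)
    (hSD : heckeSelfDual_torsionBy_J0) (hBz : buzzard2000_multiplicityOne_gamma0)
    (hSe : serre1972_supersingular_decompositionSubgroup_image)
    (hμ0 : ∀ (W : WeierstrassCurve ℚ) [W.IsElliptic] [W.IsGloballyMinimal], ¬ W.HasCM → W.analyticRank = 0 → Literature.NumberTheory.EllipticCurves.Rank1Residual.GoodSS W 2 → W.frobeniusTrace 2 = 0 → W.Δ < 0 → ∀ [NeZero (W.conductorNorm ℤ)] (f : CuspForm (CongruenceSubgroup.Gamma0 (W.conductorNorm ℤ)) 2), Literature.NumberTheory.EllipticCurves.ModularForms.IsNewformOf W f → ∃ n₁ : ℕ, Even n₁ ∧ ∃ s : ZMod (2 ^ n₁), ∀ r : ℚ, ‖algebraMap ℚ (PadicAlgCl 2) (Literature.NumberTheory.EllipticCurves.ratPlusSymbol f r)‖ ≤ ‖algebraMap ℚ (PadicAlgCl 2) (Literature.NumberTheory.EllipticCurves.ratPlusSymbol f (((((Literature.NumberTheory.EllipticCurves.cyclotomicGenerator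 2 : ZMod (2 ^ (n₁ + 2))) ^ s.val).val : ℚ) / (2 : ℚ) ^ (n₁ + 2))))‖)
    (hD : Deligne1974_heckeT_eigenvalue_norm_le) :
    Summit.BirchSwinnertonDyer.BirchSwinnertonDyer.Theses.ResidualThetaTransportAtTwo.ThetaLayerLambdaCongruenceAtTwo :=
  thetaLayerLambdaCongruenceAtTwo_of_facts_curveMax_deligne hES hF hMK hSD hBz hSe
    (stub_curveDepletedSymbolMaxAtTwoPowerCusp_of_undepleted hμ0) hD

end Summit.BirchSwinnertonDyer.BirchSwinnertonDyer.Theorems.ThetaLayerLambdaCongruenceAtTwo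

end
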